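import Summits.HodgeConjecture.HodgeCM.Literature.GaoUllmoTheorem31_1

/-! PORT of `HodgeCM/Literature/GaoUllmoTheorem31.lean` (HodgeCMPerL run 81) — part 2: continuation of `Summits.HodgeConjecture.HodgeCM.Literature.GaoUllmoTheorem31_1` (split at a top-level declaration boundary by port_pkg.py; scope re-opened below; declarations unchanged). -/

-- port_pkg: scope re-opened for this part (file-level context, then the namespace/section stack open at the cut)
noncomputable section
open Module
attribute [local instance] Classical.propDecidable
namespace HodgeCM
namespace GaoUllmo
section EmbAct
variable {E : Type} [CommRing E] [Algebra ℚ E]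
/-- The action of an embedding `ρ : E^c → ℂ` on `Hom(E, ℂ)`: `φ ↦ ρ ∘ φ`. -/
def embAct (ρ : galoisClosure E →ₐ[ℚ] ℂ) (φ : Emb E) : Emb E := ρ.comp (corestrict E φ)

/-- (Ported verbatim from the HodgeCMPerL package; no docstring in the source.) -/
@[simp] theorem embAct_apply (ρ : galoisClosure E →ₐ[ℚ] ℂ) (φ : Emb E) (a : E) :
    embAct ρ φ a = ρ (corestrict E φ a) := rfl

/-- (Ported verbatim from the HodgeCMPerL package; no docstring in the source.) -/
theorem embAct_val (φ : Emb E) : embAct (galoisClosure E).val φ = φ := by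
  ext a; rfl

/-- An embedding `ρ : E^c → ℂ` maps `E^c` into itself (it permutes the generators `φ(a)`). -/
theorem embedding_mem_galoisClosure (ρ : galoisClosure E →ₐ[ℚ] ℂ) (x : galoisClosure E) :
    ρ x ∈ galoisClosure E := by
  obtain ⟨x, hx⟩ := x
  induction hx using IntermediateField.adjoin_induction with
  | mem z hz =>
    obtain ⟨φ, ⟨a, rfl⟩⟩ := Set.mem_iUnion.mp hz
    have : ρ ⟨φ a, IntermediateField.subset_adjoin ℚ _ hz⟩ = embAct ρ φ a := rfl
    rw [this]
    exact range_subset_galoisClosure E (embAct ρ φ) ⟨a, rfl⟩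
  | algebraMap q =>
    have : (⟨algebraMap ℚ ℂ q, IntermediateField.algebraMap_mem _ q⟩ : galoisClosure E) =
        algebraMap ℚ (galoisClosure E) q := rfl
    rw [this, AlgHom.commutes]
    exact IntermediateField.algebraMap_mem _ q
  | add x y hx hy ihx ihy =>
    have : (⟨x + y, add_mem hx hy⟩ : galoisClosure E) = ⟨x, hx⟩ + ⟨y, hy⟩ := rfl
    rw [this, map_add]
    exact add_mem ihx ihy
  | inv x hx ihx =>
    have : (⟨x⁻¹, inv_mem hx⟩ : galoisClosure E) = (⟨x, hx⟩ : galoisClosure E)⁻¹ := rfl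
    rw [this, map_inv₀]
    exact inv_mem ihx
  | mul x y hx hy ihx ihy =>
    have : (⟨x * y, mul_mem hx hy⟩ : galoisClosure E) = ⟨x, hx⟩ * ⟨y, hy⟩ := rfl
    rw [this, map_mul]
    exact mul_mem ihx ihy

/-- The restriction of `ρ` to an endomorphism of `E^c`. -/
def restrictEmb (ρ : galoisClosure E →ₐ[ℚ] ℂ) : galoisClosure E →ₐ[ℚ] galoisClosure E :=
  AlgHom.codRestrict ρ (galoisClosure E).toSubalgebra (embedding_mem_galoisClosure ρ)

/-- (Ported verbatim from the HodgeCMPerL package; no docstring in the source.) -/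
@[simp] theorem coe_restrictEmb_apply (ρ : galoisClosure E →ₐ[ℚ] ℂ) (x : galoisClosure E) :
    (restrictEmb ρ x : ℂ) = ρ x := rfl

end EmbAct

section Closure

variable {E : Type} [CommRing E] [Algebra ℚ E] [Module.Finite ℚ E]

/-- The finite set of generators `{φ(b_m)}`. -/
theorem range_subset_adjoin_finite (φ : Emb E) :
    Set.range φ ⊆ (IntermediateField.adjoin ℚ
      (⋃ ψ : Emb E, ψ '' Set.range (Module.finBasis ℚ E)) : Set ℂ) := by
  rintro _ ⟨a, rfl⟩
  set b := Module.finBasis ℚ E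
  have ha : a = ∑ m, b.repr a m • b m := (b.sum_repr a).symm
  rw [ha, map_sum]
  refine Subalgebra.sum_mem _ fun m _ => ?_
  rw [map_smul]
  refine Subalgebra.smul_mem _ ?_ _
  apply IntermediateField.subset_adjoin
  exact Set.mem_iUnion.mpr ⟨φ, ⟨b m, ⟨m, rfl⟩, rfl⟩⟩

/-- (Ported verbatim from the HodgeCMPerL package; no docstring in the source.) -/
theorem galoisClosure_le_adjoin_finite :
    galoisClosure E ≤ IntermediateField.adjoin ℚ (⋃ ψ : Emb E, ψ '' Set.range (Module.finBasis ℚ E)) := by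
  rw [galoisClosure, IntermediateField.adjoin_le_iff]
  intro z hz
  obtain ⟨φ, hφ⟩ := Set.mem_iUnion.mp hz
  exact range_subset_adjoin_finite φ hφ

/-- (Ported verbatim from the HodgeCMPerL package; no docstring in the source.) -/
instance finiteDimensional_galoisClosure : FiniteDimensional ℚ (galoisClosure E) := by
  have hfin : (⋃ ψ : Emb E, ψ '' Set.range (Module.finBasis ℚ E)).Finite :=
    Set.finite_iUnion fun ψ => (Set.finite_range _).image _
  haveI := hfin.to_subtype
  haveI : FiniteDimensional ℚ
      (IntermediateField.adjoin ℚ (⋃ ψ : Emb E, ψ '' Set.range (Module.finBasis ℚ E))) := by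
    apply IntermediateField.finiteDimensional_adjoin
    rintro _ ⟨_, ⟨ψ, rfl⟩, ⟨a, -, rfl⟩⟩
    exact (Algebra.IsIntegral.isIntegral (R := ℚ) a).map ψ
  exact FiniteDimensional.of_injective
    (IntermediateField.inclusion galoisClosure_le_adjoin_finite).toLinearMap
    (fun x y hxy => (IntermediateField.inclusion galoisClosure_le_adjoin_finite).injective hxy)

/-- … which is an automorphism `σ_ρ ∈ Gal(E^c/ℚ)` (an injective endomorphism of a number field). -/
def autOfEmb (ρ : galoisClosure E →ₐ[ℚ] ℂ) : galoisClosure E ≃ₐ[ℚ] galoisClosure E :=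
  AlgEquiv.ofBijective (restrictEmb ρ) (Algebra.IsAlgebraic.algHom_bijective _)

/-- (Ported verbatim from the HodgeCMPerL package; no docstring in the source.) -/
theorem galAct_autOfEmb (ρ : galoisClosure E →ₐ[ℚ] ℂ) (φ : Emb E) : galAct E (autOfEmb ρ) φ = embAct ρ φ := by
  ext a
  rw [galAct_apply, embAct_apply]
  rfl

/-- (Ported verbatim from the HodgeCMPerL package; no docstring in the source.) -/
theorem embAct_injective (ρ : galoisClosure E →ₐ[ℚ] ℂ) : Function.Injective (embAct ρ) := by
  intro φ ψ h
  apply galAct_injective (autOfEmb ρ)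
  rw [galAct_autOfEmb, galAct_autOfEmb, h]

/-- (Ported verbatim from the HodgeCMPerL package; no docstring in the source.) -/
theorem embAct_bijective (ρ : galoisClosure E →ₐ[ℚ] ℂ) : Function.Bijective (embAct ρ) :=
  (Finite.injective_iff_bijective).mp (embAct_injective ρ)

end Closure

/-! #### Stage C: the basis vectors `φ ∈ ℂ^S` as combinations of rational vectors, with `E^c`-coefficients permuted by the embeddings -/

section Coeff

variable {E : Type} [CommRing E] [Algebra ℚ E] [Module.Finite ℚ E]

omit [Module.Finite ℚ E] in
/-- Dedekind's independence of characters for `Hom(E, ℂ)`. -/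
theorem linearIndependent_emb : LinearIndependent ℂ (fun φ : Emb E => ((φ : E →* ℂ) : E → ℂ)) :=
  (linearIndependent_monoidHom E ℂ).comp (fun φ : Emb E => (φ : E →* ℂ))
    (fun _ _ hφψ => AlgHom.ext fun a => DFunLike.congr_fun hφψ a)

/-- `S ≃ {1,…,n}`, `n = [E:ℚ]` (CM algebra). -/
def embEquivFin (hE : IsCMAlgebra E) : Emb E ≃ Fin (finrank ℚ E) :=
  Fintype.equivFinOfCardEq (card_emb_eq_finrank hE)

/-- A `ℚ`-basis of `E`. -/
abbrev bE (E : Type) [CommRing E] [Algebra ℚ E] [Module.Finite ℚ E] : Basis (Fin (finrank ℚ E)) ℚ E :=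
  Module.finBasis ℚ E

/-- The matrix `(ψ_k(b_m))_{k,m}` over `ℂ` … -/
def AC (hE : IsCMAlgebra E) : Matrix (Fin (finrank ℚ E)) (Fin (finrank ℚ E)) ℂ :=
  Matrix.of fun k m => ((embEquivFin hE).symm k) (bE E m)

/-- … and over `E^c`. -/
def AL (hE : IsCMAlgebra E) : Matrix (Fin (finrank ℚ E)) (Fin (finrank ℚ E)) (galoisClosure E) :=
  Matrix.of fun k m => corestrict E ((embEquivFin hE).symm k) (bE E m)

/-- (Ported verbatim from the HodgeCMPerL package; no docstring in the source.) -/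
theorem AL_map (hE : IsCMAlgebra E) : (AL hE).map (algebraMap (galoisClosure E) ℂ) = AC hE := by
  ext k m; rfl

/-- (Ported verbatim from the HodgeCMPerL package; no docstring in the source.) -/
theorem isUnit_AC (hE : IsCMAlgebra E) : IsUnit (AC hE) := by
  rw [← Matrix.linearIndependent_rows_iff_isUnit]
  -- rows: k ↦ (m ↦ ψ_k (b m)); a relation among the rows gives a relation among the characters ψ_k
  rw [linearIndependent_iff']
  intro s c hc k hk
  have hfun : ∑ i ∈ s, c i • (fun a : E => ((embEquivFin hE).symm i) a) = 0 := by
    funext a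
    have ha : a = ∑ m, (bE E).repr a m • bE E m := ((bE E).sum_repr a).symm
    simp only [Finset.sum_apply, Pi.smul_apply, smul_eq_mul, Pi.zero_apply]
    have hrow : ∀ i, ((embEquivFin hE).symm i) a = ∑ m, ((bE E).repr a m : ℂ) * ((embEquivFin hE).symm i) (bE E m) := by
      intro i
      conv_lhs => rw [ha]
      rw [map_sum]
      refine Finset.sum_congr rfl fun m _ => ?_
      rw [map_smul, Algebra.smul_def]
      rfl
    simp_rw [hrow, Finset.mul_sum]
    rw [Finset.sum_comm]
    refine Finset.sum_eq_zero fun m _ => ?_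
    have hcm := congr_fun hc m
    simp only [Finset.sum_apply, Pi.smul_apply, smul_eq_mul, Pi.zero_apply, Matrix.row_apply] at hcm
    calc ∑ i ∈ s, c i * (((bE E).repr a m : ℂ) * ((embEquivFin hE).symm i) (bE E m))
        = ((bE E).repr a m : ℂ) * ∑ i ∈ s, c i * AC hE i m := by
          rw [Finset.mul_sum]; refine Finset.sum_congr rfl fun i _ => ?_; simp only [AC, Matrix.of_apply]; ring
      _ = 0 := by rw [hcm, mul_zero]
  have hli := (linearIndependent_emb (E := E)).comp (embEquivFin hE).symm (embEquivFin hE).symm.injective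
  rw [linearIndependent_iff'] at hli
  exact hli s c hfun k hk

/-- (Ported verbatim from the HodgeCMPerL package; no docstring in the source.) -/
theorem isUnit_AL_det (hE : IsCMAlgebra E) : IsUnit (AL hE).det := by
  rw [isUnit_iff_ne_zero]
  intro h
  have h2 : (AC hE).det = 0 := by
    rw [← AL_map, ← RingHom.mapMatrix_apply, ← RingHom.map_det, h, map_zero]
  exact (Matrix.isUnit_iff_isUnit_det _ |>.mp (isUnit_AC hE)).ne_zero h2

/-- `C = (ᵗA)⁻¹` over `E^c` and over `ℂ`. -/
def CL (hE : IsCMAlgebra E) : Matrix (Fin (finrank ℚ E)) (Fin (finrank ℚ E)) (galoisClosure E) := ((AL hE).transpose)⁻¹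

/-- (Ported verbatim from the HodgeCMPerL package; no docstring in the source.) -/
def CC (hE : IsCMAlgebra E) : Matrix (Fin (finrank ℚ E)) (Fin (finrank ℚ E)) ℂ := ((AC hE).transpose)⁻¹

/-- (Ported verbatim from the HodgeCMPerL package; no docstring in the source.) -/
theorem CL_mul (hE : IsCMAlgebra E) : CL hE * (AL hE).transpose = 1 :=
  Matrix.nonsing_inv_mul _ (by rw [Matrix.det_transpose]; exact isUnit_AL_det hE)

/-- **`φ = Σ_m C_{φ m} · b_m`** in `ℂ^S`: the standard basis vector `φ` is an `E^c`-combination of the rational vectors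
`ratVec(b_m)`. -/
theorem e_eq_sum (hE : IsCMAlgebra E) (φ : Emb E) :
    e E φ = ∑ m, ((CL hE (embEquivFin hE φ) m : galoisClosure E) : ℂ) • ratVec E (bE E m) := by
  ext ψ
  simp only [e, Pi.basisFun_apply, Finset.sum_apply, Pi.smul_apply, ratVec_apply, smul_eq_mul]
  have h := congr_fun (congr_fun (CL_mul hE) (embEquivFin hE φ)) (embEquivFin hE ψ)
  rw [Matrix.mul_apply] at h
  have h' : ∑ m, ((CL hE (embEquivFin hE φ) m : galoisClosure E) : ℂ) * ψ (bE E m) =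
      (((1 : Matrix _ _ (galoisClosure E)) (embEquivFin hE φ) (embEquivFin hE ψ) : galoisClosure E) : ℂ) := by
    rw [← h]
    push_cast
    refine Finset.sum_congr rfl fun m _ => ?_
    simp only [Matrix.transpose_apply, AL, Matrix.of_apply, Equiv.symm_apply_apply, coe_corestrict_apply]
  rw [h', Matrix.one_apply]
  by_cases hφψ : φ = ψ
  · subst hφψ; simp
  · have : embEquivFin hE φ ≠ embEquivFin hE ψ := fun h => hφψ ((embEquivFin hE).injective h)
    rw [if_neg this, Pi.single_eq_of_ne' hφψ]
    simp

/-- The permutation of `{1,…,n}` induced by `ρ` on `S`. -/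
def permOfEmb (hE : IsCMAlgebra E) (ρ : galoisClosure E →ₐ[ℚ] ℂ) : Equiv.Perm (Fin (finrank ℚ E)) :=
  (embEquivFin hE).symm.trans ((Equiv.ofBijective _ (embAct_bijective ρ)).trans (embEquivFin hE))

/-- (Ported verbatim from the HodgeCMPerL package; no docstring in the source.) -/
theorem embEquivFin_symm_permOfEmb (hE : IsCMAlgebra E) (ρ : galoisClosure E →ₐ[ℚ] ℂ) (k : Fin (finrank ℚ E)) :
    (embEquivFin hE).symm (permOfEmb hE ρ k) = embAct ρ ((embEquivFin hE).symm k) := by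
  simp [permOfEmb]

/-- (Ported verbatim from the HodgeCMPerL package; no docstring in the source.) -/
theorem AL_map_emb (hE : IsCMAlgebra E) (ρ : galoisClosure E →ₐ[ℚ] ℂ) :
    (AL hE).map ρ = (AC hE).submatrix (permOfEmb hE ρ) id := by
  ext k m
  simp only [Matrix.map_apply, AL, AC, Matrix.of_apply, Matrix.submatrix_apply, id_eq, embEquivFin_symm_permOfEmb,
    embAct_apply]

/-- **Equivariance of the coefficients**: `ρ(C_{φ m}) = C_{ρφ, m}`. -/
theorem map_CL (hE : IsCMAlgebra E) (ρ : galoisClosure E →ₐ[ℚ] ℂ) :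
    (CL hE).map ρ = (CC hE).submatrix (permOfEmb hE ρ) id := by
  have hinv : (CL hE).map ρ = (((AL hE).transpose).map ρ)⁻¹ := by
    apply (Matrix.inv_eq_left_inv _).symm
    rw [← Matrix.map_mul, CL_mul, Matrix.map_one _ (map_zero ρ) (map_one ρ)]
  rw [hinv, Matrix.transpose_map, AL_map_emb, Matrix.transpose_submatrix, CC]
  have : ((AC hE).transpose.submatrix id (permOfEmb hE ρ)) =
      (AC hE).transpose.submatrix (Equiv.refl _) (permOfEmb hE ρ) := rfl
  rw [this, Matrix.inv_submatrix_equiv]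
  rfl

end Coeff

/-! #### Stage D: the averaged classes `f_u = Σ_ρ ρ(u) · ρ[P]` are rational Hodge classes -/

section Descent

variable {E : Type} [CommRing E] [Algebra ℚ E] [Module.Finite ℚ E] [LinearOrder (Emb E)]

omit [LinearOrder (Emb E)] in
/-- (Ported verbatim from the HodgeCMPerL package; no docstring in the source.) -/
theorem permOfEmb_val (hE : IsCMAlgebra E) : permOfEmb hE (galoisClosure E).val = Equiv.refl _ := by
  ext k : 1
  apply (embEquivFin hE).symm.injective
  rw [embEquivFin_symm_permOfEmb, embAct_val]
  rfl

omit [LinearOrder (Emb E)] in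
/-- (Ported verbatim from the HodgeCMPerL package; no docstring in the source.) -/
theorem coe_CL (hE : IsCMAlgebra E) (k m : Fin (finrank ℚ E)) :
    ((CL hE k m : galoisClosure E) : ℂ) = CC hE k m := by
  have h := congr_fun (congr_fun (map_CL hE (galoisClosure E).val) k) m
  rw [Matrix.map_apply, permOfEmb_val] at h
  exact h

omit [LinearOrder (Emb E)] in
/-- (Ported verbatim from the HodgeCMPerL package; no docstring in the source.) -/
theorem permOfEmb_apply_embEquivFin (hE : IsCMAlgebra E) (ρ : galoisClosure E →ₐ[ℚ] ℂ) (χ : Emb E) :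
    permOfEmb hE ρ (embEquivFin hE χ) = embEquivFin hE (embAct ρ χ) := by
  apply (embEquivFin hE).symm.injective
  rw [embEquivFin_symm_permOfEmb]
  simp

omit [LinearOrder (Emb E)] in
/-- `ρ(C_{χ m}) = C_{ρχ, m}` in coordinates. -/
theorem map_CL_apply (hE : IsCMAlgebra E) (ρ : galoisClosure E →ₐ[ℚ] ℂ) (χ : Emb E) (m : Fin (finrank ℚ E)) :
    ρ (CL hE (embEquivFin hE χ) m) = ((CL hE (embEquivFin hE (embAct ρ χ)) m : galoisClosure E) : ℂ) := by
  have h := congr_fun (congr_fun (map_CL hE ρ) (embEquivFin hE χ)) m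
  rw [Matrix.map_apply, Matrix.submatrix_apply, id_eq, permOfEmb_apply_embEquivFin] at h
  rw [h, coe_CL]

/-- `ρ[P] := ⋀_k e_{ρ ∘ φ_k}`, `φ₁ < ⋯ < φ_r` the elements of `P` (the paper's `[σP]`, with its natural sign). -/
def Tvec (r : ℕ) (P : Set.powersetCard (Emb E) r) (ρ : galoisClosure E →ₐ[ℚ] ℂ) : Hr E r :=
  exteriorPower.ιMulti ℂ r (fun k => e E (embAct ρ (Set.powersetCard.ofFinEmbEquiv.symm P k)))

/-- (Ported verbatim from the HodgeCMPerL package; no docstring in the source.) -/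
theorem Tvec_val (r : ℕ) (P : Set.powersetCard (Emb E) r) : Tvec r P (galoisClosure E).val = wedge E r P := by
  simp only [Tvec, embAct_val, wedge, exteriorPower.basis_apply]
  rfl

/-- `f_u := Σ_ρ ρ(u) · ρ[P]`. -/
def fvec (r : ℕ) (P : Set.powersetCard (Emb E) r) (u : galoisClosure E) : Hr E r :=
  ∑ ρ : galoisClosure E →ₐ[ℚ] ℂ, (ρ u) • Tvec r P ρ

/-- Expansion of `ρ[P]` in wedges of rational vectors: `ρ[P] = Σ_g ρ(∏_k C_{φ_k, g(k)}) · ⋀_k b_{g(k)}`. -/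
theorem Tvec_eq_sum (hE : IsCMAlgebra E) (r : ℕ) (P : Set.powersetCard (Emb E) r) (ρ : galoisClosure E →ₐ[ℚ] ℂ) :
    Tvec r P ρ = ∑ g : Fin r → Fin (finrank ℚ E),
      ρ (∏ k, CL hE (embEquivFin hE (Set.powersetCard.ofFinEmbEquiv.symm P k)) (g k)) •
        exteriorPower.ιMulti ℂ r (fun k => ratVec E (bE E (g k))) := by
  unfold Tvec
  have hfun : (fun k => e E (embAct ρ (Set.powersetCard.ofFinEmbEquiv.symm P k))) =
      fun k => ∑ m, (ρ (CL hE (embEquivFin hE (Set.powersetCard.ofFinEmbEquiv.symm P k)) m)) • ratVec E (bE E m) := by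
    funext k
    rw [e_eq_sum hE]
    refine Finset.sum_congr rfl fun m _ => ?_
    rw [map_CL_apply]
  rw [hfun]
  have h1 := (exteriorPower.ιMulti ℂ r (M := VC E)).toMultilinearMap.map_sum
    (fun k m => (ρ (CL hE (embEquivFin hE (Set.powersetCard.ofFinEmbEquiv.symm P k)) m)) • ratVec E (bE E m))
  rw [AlternatingMap.coe_multilinearMap] at h1
  rw [h1]
  refine Finset.sum_congr rfl fun g _ => ?_
  rw [map_prod]
  exact (exteriorPower.ιMulti ℂ r (M := VC E)).toMultilinearMap.map_smul_univ _ _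

/-- **`f_u` is a rational class** (`∈ H^r(A, ℚ)`): its coefficients are the traces `Tr_{E^c/ℚ}(u ∏_k C_{φ_k, g(k)})`. -/
theorem fvec_mem_ratStr (hE : IsCMAlgebra E) (r : ℕ) (P : Set.powersetCard (Emb E) r) (u : galoisClosure E) :
    fvec r P u ∈ ratStr E r := by
  unfold fvec
  simp_rw [Tvec_eq_sum hE, Finset.smul_sum, smul_smul, ← map_mul]
  rw [Finset.sum_comm]
  refine Submodule.sum_mem _ fun g _ => ?_
  rw [← Finset.sum_smul, ← trace_eq_sum_embeddings ℂ, algebraMap_smul]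
  exact Submodule.smul_mem _ _ (Submodule.subset_span ⟨fun k => bE E (g k), rfl⟩)

end Descent

section Final

variable {E : Type} [CommRing E] [Algebra ℚ E] [Module.Finite ℚ E] [LinearOrder (Emb E)]

omit [Module.Finite ℚ E] [LinearOrder (Emb E)] in
/-- A set of cardinality `2p` satisfying `|Q ∩ Φ| = |Q ∩ Φ̄|` has type `(p,p)`. -/
theorem type_of_card_eq (Φ : CMTypeOn E) {p : ℕ} (Q : Finset (Emb E)) (hcard : Q.card = 2 * p)
    (h : (Q ∩ Φ.Φ).card = (Q ∩ Φ.bar).card) : (Q ∩ Φ.Φ).card = p ∧ (Q ∩ Φ.bar).card = p := by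
  have h1 : Q ∩ Φ.Φ = Q.filter (fun φ => φ ∈ Φ.Φ) := by
    ext φ; simp [Finset.mem_filter]
  have h2 : Q ∩ Φ.bar = Q.filter (fun φ => ¬ φ ∈ Φ.Φ) := by
    ext φ; simp [Finset.mem_filter, CMTypeOn.mem_bar_iff]
  have hsum := Finset.card_filter_add_card_filter_not (s := Q) (fun φ => φ ∈ Φ.Φ)
  rw [← h1, ← h2, hcard] at hsum
  omega

/-- `ρ[P] = ± [σ_ρ P]`; hence, if `P` satisfies (3.2), `ρ[P] ∈ H^{p,p}`. -/
theorem Tvec_mem_Hpp (Φ : CMTypeOn E) (p : ℕ) (P : Set.powersetCard (Emb E) (2 * p))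
    (h32 : SatisfiesEq32 Φ (P : Finset (Emb E))) (ρ : galoisClosure E →ₐ[ℚ] ℂ) :
    Tvec (2 * p) P ρ ∈ Hpp Φ p := by
  obtain ⟨π, hπ⟩ := exists_perm_enum (autOfEmb ρ) P
  set Q := galActPC (autOfEmb ρ) P with hQ
  have hfun : (fun k => e E (embAct ρ (Set.powersetCard.ofFinEmbEquiv.symm P k))) =
      (fun k => e E (Set.powersetCard.ofFinEmbEquiv.symm Q k)) ∘ π := by
    funext k
    simp only [Function.comp_apply]
    rw [← galAct_autOfEmb, hπ k]
  have hT : Tvec (2 * p) P ρ = (Equiv.Perm.sign π : ℤˣ) • wedge E (2 * p) Q := by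
    unfold Tvec
    rw [hfun, AlternatingMap.map_perm]
    congr 1
    simp only [wedge, exteriorPower.basis_apply]
    rfl
  have htype : ((Q : Finset (Emb E)) ∩ Φ.Φ).card = p ∧ ((Q : Finset (Emb E)) ∩ Φ.bar).card = p :=
    type_of_card_eq Φ _ Q.prop (by rw [hQ, galActPC_val]; exact h32 (autOfEmb ρ))
  rw [hT, Units.smul_def]
  apply Submodule.smul_of_tower_mem
  exact Submodule.subset_span ⟨Q, htype.1, htype.2, rfl⟩

/-- `f_u ∈ B^p(A)` for every `u ∈ E^c`, when `P` satisfies (3.2). -/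
theorem fvec_mem_Bp (hE : IsCMAlgebra E) (Φ : CMTypeOn E) (p : ℕ) (P : Set.powersetCard (Emb E) (2 * p))
    (h32 : SatisfiesEq32 Φ (P : Finset (Emb E))) (u : galoisClosure E) : fvec (2 * p) P u ∈ Bp Φ p := by
  refine Submodule.mem_inf.mpr ⟨fvec_mem_ratStr hE (2 * p) P u, ?_⟩
  show fvec (2 * p) P u ∈ Hpp Φ p
  unfold fvec
  exact Submodule.sum_mem _ fun ρ _ => Submodule.smul_mem _ _ (Tvec_mem_Hpp Φ p P h32 ρ)


-- port_pkg: scope closed for this part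
end Final
end GaoUllmo
end HodgeCM
end
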